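import Literature.Probability.LatticeModels.MedialInterfaceProofs
import HarnessLib

/-!
# The nearest-neighbour Laplacian on `ℤ²`: sub/superharmonic functions and the maximum principle

Topic `Literature/Probability/LatticeModels`; first piece of the discrete harmonic toolkit
(nodes 5–6) of the discharge programme for crit-ising.S18 / Smirnov's Theorem 2.2
(`Sweep1Proofs.lean`, module docstring §2). In S. Smirnov, *Conformal invariance in random
cluster models. I*, Ann. of Math. 172 (2010), §3.3, the primitive `H = Im ∫ F²` restricted to the
black (resp. white) squares of the medial lattice — i.e. to the faces (resp. vertices) of `δℤ²`,
see `SHolomorphicPrimitive.lean` — is a function on a copy of `ℤ²` whose Laplacian is "the sum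
over the four squares `B_j` touching `B` at vertices", i.e. the usual nearest-neighbour Laplacian
`Δ H (v) = ∑_{k<4} (H(v + e_k) - H(v))` (before Lemma 3.8); Lemma 3.8 says `Δ H^b ≥ 0`,
`Δ H^w ≤ 0`, and the proof of Lemma 5.2 sandwiches `H` between discrete harmonic functions by
the maximum principle ("on the boundary, and hence inside the domain, since the four functions
involved are superharmonic, harmonic, harmonic and subharmonic correspondingly").

Contents (all proved; Mathlib has no discrete harmonic functions on lattices):

* `latticeLaplacian H v = ∑ k : Fin 4, (H (v + cornerUnit k) - H v)` and its linearity;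
* `IsLatticeSubharmonicOn / IsLatticeSuperharmonicOn / IsLatticeHarmonicOn H S`;
* `latticeOuterBoundary S` (sites outside `S` with a neighbour in `S`), finite for finite `S`;
* **the maximum principle** `IsLatticeSubharmonicOn.le_of_forall_boundary_le`: on a finite set
  `S`, a subharmonic function bounded by `M` on the outer boundary is bounded by `M` on `S`
  (proof: a maximiser over `S ∪ ∂S` inside `S` propagates eastwards along `v + n e₀` by the mean
  value inequality until it leaves the finite set `S`, landing on `∂S`); the minimum principle for
  superharmonic functions and the comparison principle `sub ≤ super` given the boundary
  inequality (`le_of_sub_super_of_boundary`), which is the form used in Lemma 5.2;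
* **the discrete Dirichlet problem on a finite set**: uniqueness
  (`IsLatticeHarmonicOn.eq_of_eq_boundary`) and existence (`exists_isLatticeHarmonicOn_eq_off`,
  by finite-dimensional linear algebra: the Dirichlet operator `u ↦ (Δ extendByZero u)|_S` is
  injective by the maximum principle, hence surjective) — "the discrete harmonic function with
  boundary values given by `h`" of the proof of Lemma 5.2.

References: Smirnov 2010, §3.3 and proof of Lemma 5.2; for the classical statements e.g.
G. Lawler, V. Limic, *Random Walk: A Modern Introduction* (2010), §6.1 (discrete maximum
principle). Everything here is [folklore].
-/

noncomputable section

namespace Literature.Probability.LatticeModels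

open Finset

/-! ### The Laplacian -/

/-- The nearest-neighbour **lattice Laplacian** on `ℤ²`:
`Δ H (v) = ∑_{k<4} (H(v + e_k) - H(v))`, `e_k = cornerUnit k` the four unit vectors
(Smirnov 2010, §3.3, display before Lemma 3.8: "the sum is taken over four squares — neighbors
touching at vertices"). [folklore] -/
def latticeLaplacian (H : Site 2 → ℝ) (v : Site 2) : ℝ :=
  ∑ k : Fin 4, (H (v + cornerUnit k) - H v)

/-- `Δ H (v) = (∑_k H(v + e_k)) - 4 H(v)`. [folklore] -/
theorem latticeLaplacian_eq (H : Site 2 → ℝ) (v : Site 2) :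
    latticeLaplacian H v = (∑ k : Fin 4, H (v + cornerUnit k)) - 4 * H v := by
  rw [latticeLaplacian, Finset.sum_sub_distrib]
  simp

/-- The Laplacian is additive. [folklore] -/
theorem latticeLaplacian_add (H₁ H₂ : Site 2 → ℝ) (v : Site 2) :
    latticeLaplacian (H₁ + H₂) v = latticeLaplacian H₁ v + latticeLaplacian H₂ v := by
  simp only [latticeLaplacian, Pi.add_apply, ← Finset.sum_add_distrib]
  refine Finset.sum_congr rfl fun k _ => ?_
  ring

/-- The Laplacian commutes with negation. [folklore] -/
theorem latticeLaplacian_neg (H : Site 2 → ℝ) (v : Site 2) :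
    latticeLaplacian (-H) v = -latticeLaplacian H v := by
  simp only [latticeLaplacian, Pi.neg_apply, ← Finset.sum_neg_distrib]
  refine Finset.sum_congr rfl fun k _ => ?_
  ring

/-- The Laplacian of a difference. [folklore] -/
theorem latticeLaplacian_sub (H₁ H₂ : Site 2 → ℝ) (v : Site 2) :
    latticeLaplacian (H₁ - H₂) v = latticeLaplacian H₁ v - latticeLaplacian H₂ v := by
  rw [sub_eq_add_neg, latticeLaplacian_add, latticeLaplacian_neg, ← sub_eq_add_neg]

/-- The Laplacian is homogeneous. [folklore] -/
theorem latticeLaplacian_const_mul (c : ℝ) (H : Site 2 → ℝ) (v : Site 2) :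
    latticeLaplacian (fun x => c * H x) v = c * latticeLaplacian H v := by
  simp only [latticeLaplacian, Finset.mul_sum]
  refine Finset.sum_congr rfl fun k _ => ?_
  ring

/-- Constants are harmonic. [folklore] -/
theorem latticeLaplacian_const (c : ℝ) (v : Site 2) : latticeLaplacian (fun _ => c) v = 0 := by
  simp [latticeLaplacian]

/-- Adding a constant does not change the Laplacian. [folklore] -/
theorem latticeLaplacian_add_const (H : Site 2 → ℝ) (c : ℝ) (v : Site 2) :
    latticeLaplacian (fun x => H x + c) v = latticeLaplacian H v := by
  simp [latticeLaplacian]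

/-! ### Sub/superharmonic functions and the outer boundary -/

/-- `H` is **(discrete) subharmonic** on `S`: `Δ H ≥ 0` at every site of `S` (Smirnov 2010, §3.3). [folklore] -/
def IsLatticeSubharmonicOn (H : Site 2 → ℝ) (S : Set (Site 2)) : Prop :=
  ∀ v ∈ S, 0 ≤ latticeLaplacian H v

/-- `H` is **(discrete) superharmonic** on `S`: `Δ H ≤ 0` on `S`. [folklore] -/
def IsLatticeSuperharmonicOn (H : Site 2 → ℝ) (S : Set (Site 2)) : Prop :=
  ∀ v ∈ S, latticeLaplacian H v ≤ 0

/-- `H` is **(discrete) harmonic** on `S`: `Δ H = 0` on `S`. [folklore] -/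
def IsLatticeHarmonicOn (H : Site 2 → ℝ) (S : Set (Site 2)) : Prop :=
  ∀ v ∈ S, latticeLaplacian H v = 0

/-- Harmonic functions are subharmonic. [folklore] -/
theorem IsLatticeHarmonicOn.subharmonicOn {H : Site 2 → ℝ} {S : Set (Site 2)}
    (h : IsLatticeHarmonicOn H S) : IsLatticeSubharmonicOn H S := fun v hv => (h v hv).ge

/-- Harmonic functions are superharmonic. [folklore] -/
theorem IsLatticeHarmonicOn.superharmonicOn {H : Site 2 → ℝ} {S : Set (Site 2)}
    (h : IsLatticeHarmonicOn H S) : IsLatticeSuperharmonicOn H S := fun v hv => (h v hv).le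

/-- `H` is superharmonic iff `-H` is subharmonic. [folklore] -/
theorem IsLatticeSuperharmonicOn.neg {H : Site 2 → ℝ} {S : Set (Site 2)}
    (h : IsLatticeSuperharmonicOn H S) : IsLatticeSubharmonicOn (-H) S := fun v hv => by
  rw [latticeLaplacian_neg]
  exact neg_nonneg.2 (h v hv)

/-- A subharmonic minus a superharmonic function is subharmonic. [folklore] -/
theorem IsLatticeSubharmonicOn.sub {H₁ H₂ : Site 2 → ℝ} {S : Set (Site 2)}
    (h₁ : IsLatticeSubharmonicOn H₁ S) (h₂ : IsLatticeSuperharmonicOn H₂ S) :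
    IsLatticeSubharmonicOn (H₁ - H₂) S := fun v hv => by
  rw [latticeLaplacian_sub]
  linarith [h₁ v hv, h₂ v hv]

/-- The **outer (vertex) boundary** of `S ⊆ ℤ²`: the sites outside `S` having a nearest neighbour
in `S` (the squares "adjacent to `Ω`" on which Smirnov reads the boundary values of `H`, §3.3
before Lemma 3.10). [folklore] -/
def latticeOuterBoundary (S : Set (Site 2)) : Set (Site 2) :=
  {w | w ∉ S ∧ ∃ v ∈ S, ∃ k : Fin 4, w = v + cornerUnit k}

/-- A neighbour of a site of `S` lies in `S` or in its outer boundary. [folklore] -/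
theorem add_cornerUnit_mem_union {S : Set (Site 2)} {v : Site 2} (hv : v ∈ S) (k : Fin 4) :
    v + cornerUnit k ∈ S ∪ latticeOuterBoundary S := by
  by_cases h : v + cornerUnit k ∈ S
  · exact Or.inl h
  · exact Or.inr ⟨h, v, hv, k, rfl⟩

/-- The outer boundary of a finite set is finite. [folklore] -/
theorem latticeOuterBoundary_finite {S : Set (Site 2)} (hS : S.Finite) :
    (latticeOuterBoundary S).Finite := by
  refine (hS.biUnion (t := fun v => Set.range fun k : Fin 4 => v + cornerUnit k)
    fun v _ => Set.finite_range _).subset ?_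
  rintro w ⟨-, v, hv, k, rfl⟩
  exact Set.mem_biUnion hv ⟨k, rfl⟩

/-! ### The maximum principle -/

/-- **Mean value inequality at a maximum.** If `H` is subharmonic at `v`, `H v = M` and all four
neighbours are `≤ M`, then all four neighbours equal `M`. [folklore] -/
theorem eq_of_latticeLaplacian_nonneg {H : Site 2 → ℝ} {v : Site 2} {M : ℝ}
    (hΔ : 0 ≤ latticeLaplacian H v) (hv : H v = M) (hle : ∀ k : Fin 4, H (v + cornerUnit k) ≤ M)
    (k : Fin 4) : H (v + cornerUnit k) = M := by
  have hnonpos : ∀ j ∈ (univ : Finset (Fin 4)), H (v + cornerUnit j) - H v ≤ 0 := fun j _ => by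
    rw [hv]; linarith [hle j]
  have hsum : ∑ j : Fin 4, (H (v + cornerUnit j) - H v) = 0 :=
    le_antisymm (Finset.sum_nonpos hnonpos) hΔ
  have := (Finset.sum_eq_zero_iff_of_nonpos hnonpos).1 hsum k (mem_univ k)
  linarith

/-- Walking east: `(v + n e₀) 0 = v 0 + n`, so `n ↦ v + n e₀` is injective. [folklore] -/
theorem add_nsmul_cornerUnit_zero_apply (v : Site 2) (n : ℕ) :
    (v + n • cornerUnit 0) 0 = v 0 + n := by
  simp [cornerUnit]

/-- **The discrete maximum principle.** Let `S ⊆ ℤ²` be finite and `H` subharmonic on `S`. If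
`H ≤ M` on the outer boundary of `S`, then `H ≤ M` on `S`. (Smirnov 2010, proof of Lemma 5.2;
Lawler–Limic 2010, §6.1.) [folklore] -/
theorem IsLatticeSubharmonicOn.le_of_forall_boundary_le {H : Site 2 → ℝ} {S : Set (Site 2)}
    (hS : S.Finite) (h : IsLatticeSubharmonicOn H S) {M : ℝ}
    (hM : ∀ w ∈ latticeOuterBoundary S, H w ≤ M) : ∀ v ∈ S, H v ≤ M := by
  intro v₁ hv₁
  by_contra hlt
  push Not at hlt
  -- a maximiser of `H` over the finite set `T = S ∪ ∂S`
  set T := S ∪ latticeOuterBoundary S with hT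
  have hTfin : T.Finite := hS.union (latticeOuterBoundary_finite hS)
  obtain ⟨v₀, hv₀T, hmax⟩ := Set.exists_max_image T H hTfin ⟨v₁, Or.inl hv₁⟩
  set M' := H v₀ with hM'
  have hMM' : M < M' := lt_of_lt_of_le hlt (hmax v₁ (Or.inl hv₁))
  -- the maximiser is not on the boundary, hence in `S`; propagate eastwards
  have key : ∀ n : ℕ, (∀ m < n, v₀ + m • cornerUnit 0 ∈ S) →
      H (v₀ + n • cornerUnit 0) = M' ∧ v₀ + n • cornerUnit 0 ∈ T := by
    intro n
    induction n with
    | zero => intro; simp [hM', hv₀T]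
    | succ n ih =>
      intro hn
      have hnS : v₀ + n • cornerUnit 0 ∈ S := hn n n.lt_succ_self
      have ih' := ih fun m hm => hn m (hm.trans n.lt_succ_self)
      have hstep : v₀ + (n + 1) • cornerUnit 0 = v₀ + n • cornerUnit 0 + cornerUnit 0 := by
        rw [succ_nsmul, add_assoc]
      rw [hstep]
      refine ⟨eq_of_latticeLaplacian_nonneg (h _ hnS) ih'.1 (fun k => hmax _ ?_) 0,
        add_cornerUnit_mem_union hnS 0⟩
      exact add_cornerUnit_mem_union hnS k
  -- the eastward ray leaves the finite set `S`
  have hex : ∃ n : ℕ, v₀ + n • cornerUnit 0 ∉ S := by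
    by_contra hall
    push Not at hall
    refine hS.not_infinite (Set.infinite_of_injective_forall_mem (f := fun n : ℕ => v₀ + n • cornerUnit 0)
      (fun a b hab => ?_) hall)
    have h' := congrArg (fun x : Site 2 => x 0) hab
    simp only [add_nsmul_cornerUnit_zero_apply, add_right_inj, Nat.cast_inj] at h'
    exact h'
  classical
  let n := Nat.find hex
  have hn : v₀ + n • cornerUnit 0 ∉ S := Nat.find_spec hex
  have hlt' : ∀ m < n, v₀ + m • cornerUnit 0 ∈ S := fun m hm => by
    have := Nat.find_min hex hm
    simpa using this
  obtain ⟨hHM', hnT⟩ := key n hlt'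
  have hbdry : v₀ + n • cornerUnit 0 ∈ latticeOuterBoundary S := hnT.resolve_left hn
  have := hM _ hbdry
  linarith

/-- **The discrete minimum principle** for superharmonic functions on a finite set. [folklore] -/
theorem IsLatticeSuperharmonicOn.ge_of_forall_boundary_ge {H : Site 2 → ℝ} {S : Set (Site 2)}
    (hS : S.Finite) (h : IsLatticeSuperharmonicOn H S) {M : ℝ}
    (hM : ∀ w ∈ latticeOuterBoundary S, M ≤ H w) : ∀ v ∈ S, M ≤ H v := by
  intro v hv
  have := h.neg.le_of_forall_boundary_le hS (M := -M) (fun w hw => by simpa using hM w hw) v hv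
  simpa using this

/-- **Comparison principle** (the form used in the proof of Smirnov's Lemma 5.2): on a finite set,
if `H₁` is subharmonic, `H₂` is superharmonic and `H₁ ≤ H₂ + c` on the outer boundary, then
`H₁ ≤ H₂ + c` inside. [cite: Smirnov2010, proof of Lemma 5.2] -/
theorem le_of_sub_super_of_boundary {H₁ H₂ : Site 2 → ℝ} {S : Set (Site 2)} (hS : S.Finite)
    (h₁ : IsLatticeSubharmonicOn H₁ S) (h₂ : IsLatticeSuperharmonicOn H₂ S) {c : ℝ}
    (hb : ∀ w ∈ latticeOuterBoundary S, H₁ w ≤ H₂ w + c) : ∀ v ∈ S, H₁ v ≤ H₂ v + c := by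
  intro v hv
  have key := (h₁.sub h₂).le_of_forall_boundary_le hS (M := c)
    (fun w hw => by rw [Pi.sub_apply, sub_le_iff_le_add']; exact hb w hw) v hv
  rw [Pi.sub_apply, sub_le_iff_le_add'] at key
  exact key

/-! ### The discrete Dirichlet problem on a finite set -/

/-- **Uniqueness for the discrete Dirichlet problem.** Two functions harmonic on a finite set `S`
which agree on its outer boundary agree on `S` (comparison principle both ways). [folklore] -/
theorem IsLatticeHarmonicOn.eq_of_eq_boundary {u₁ u₂ : Site 2 → ℝ} {S : Set (Site 2)}
    (hS : S.Finite) (h₁ : IsLatticeHarmonicOn u₁ S) (h₂ : IsLatticeHarmonicOn u₂ S)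
    (hb : ∀ w ∈ latticeOuterBoundary S, u₁ w = u₂ w) : ∀ v ∈ S, u₁ v = u₂ v := by
  intro v hv
  have h12 := le_of_sub_super_of_boundary hS h₁.subharmonicOn h₂.superharmonicOn (c := 0)
    (fun w hw => by rw [hb w hw, add_zero]) v hv
  have h21 := le_of_sub_super_of_boundary hS h₂.subharmonicOn h₁.superharmonicOn (c := 0)
    (fun w hw => by rw [hb w hw, add_zero]) v hv
  rw [add_zero] at h12 h21
  exact le_antisymm h12 h21

open scoped Classical in
/-- Extension by zero of a function on `S` to `ℤ²`. [folklore] -/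
def extendByZero (S : Set (Site 2)) (u : S → ℝ) : Site 2 → ℝ :=
  fun x => if hx : x ∈ S then u ⟨x, hx⟩ else 0

/-- `extendByZero` on `S`. [folklore] -/
theorem extendByZero_of_mem {S : Set (Site 2)} (u : S → ℝ) {x : Site 2} (hx : x ∈ S) :
    extendByZero S u x = u ⟨x, hx⟩ := by
  simp [extendByZero, hx]

/-- `extendByZero` off `S`. [folklore] -/
theorem extendByZero_of_not_mem {S : Set (Site 2)} (u : S → ℝ) {x : Site 2} (hx : x ∉ S) :
    extendByZero S u x = 0 := by
  simp [extendByZero, hx]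

/-- `extendByZero` is additive. [folklore] -/
theorem extendByZero_add (S : Set (Site 2)) (u₁ u₂ : S → ℝ) :
    extendByZero S (u₁ + u₂) = extendByZero S u₁ + extendByZero S u₂ := by
  funext x
  by_cases hx : x ∈ S <;> simp [extendByZero, hx]

/-- `extendByZero` is homogeneous. [folklore] -/
theorem extendByZero_smul (S : Set (Site 2)) (c : ℝ) (u : S → ℝ) :
    extendByZero S (c • u) = fun x => c * extendByZero S u x := by
  funext x
  by_cases hx : x ∈ S <;> simp [extendByZero, hx]

/-- **The Dirichlet operator** of the finite set `S`: `u ↦ (Δ (extendByZero u))|_S`, a linear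
endomorphism of `S → ℝ`. [folklore] -/
def dirichletOperator (S : Set (Site 2)) : (S → ℝ) →ₗ[ℝ] (S → ℝ) where
  toFun u := fun v => latticeLaplacian (extendByZero S u) v
  map_add' u₁ u₂ := by
    funext v
    rw [extendByZero_add, latticeLaplacian_add]
    rfl
  map_smul' c u := by
    funext v
    rw [extendByZero_smul, latticeLaplacian_const_mul]
    rfl

/-- The Dirichlet operator of a finite set is injective: a function harmonic on `S` vanishing off
`S` vanishes (maximum and minimum principles). [folklore] -/
theorem dirichletOperator_injective {S : Set (Site 2)} (hS : S.Finite) :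
    Function.Injective (dirichletOperator S) := by
  refine (injective_iff_map_eq_zero _).2 fun u hu => ?_
  have hharm : IsLatticeHarmonicOn (extendByZero S u) S := fun v hv => by
    have := congrArg (fun f : S → ℝ => f ⟨v, hv⟩) hu
    simpa [dirichletOperator] using this
  have hzero : IsLatticeHarmonicOn (fun _ : Site 2 => (0 : ℝ)) S := fun v _ => latticeLaplacian_const 0 v
  funext ⟨v, hv⟩
  have key := hharm.eq_of_eq_boundary hS hzero (fun w hw => by
    rw [extendByZero_of_not_mem u hw.1]) v hv
  rw [extendByZero_of_mem u hv] at key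
  exact key

/-- **Existence and uniqueness for the discrete Dirichlet problem on a finite set.** For every
finite `S ⊆ ℤ²` and every `g : ℤ² → ℝ` there is a unique function equal to `g` off `S` and
harmonic on `S` (finite-dimensional linear algebra: the injective Dirichlet operator is
surjective). This is the "discrete harmonic function with boundary values given by `h`" of the
proof of Smirnov's Lemma 5.2; Lawler–Limic 2010, §6.1. [folklore] -/
theorem exists_isLatticeHarmonicOn_eq_off {S : Set (Site 2)} (hS : S.Finite) (g : Site 2 → ℝ) :
    ∃ u : Site 2 → ℝ, IsLatticeHarmonicOn u S ∧ ∀ w ∉ S, u w = g w := by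
  classical
  haveI : Fintype S := hS.fintype
  -- boundary data extended by `0` on `S`
  let g₀ : Site 2 → ℝ := fun x => if x ∈ S then 0 else g x
  have hsurj : Function.Surjective (dirichletOperator S) :=
    LinearMap.injective_iff_surjective.1 (dirichletOperator_injective hS)
  obtain ⟨u, hu⟩ := hsurj fun v => -latticeLaplacian g₀ v
  refine ⟨extendByZero S u + g₀, fun v hv => ?_, fun w hw => ?_⟩
  · have h1 := congrArg (fun f : S → ℝ => f ⟨v, hv⟩) hu
    simp only [dirichletOperator, LinearMap.coe_mk, AddHom.coe_mk] at h1
    rw [latticeLaplacian_add, h1]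
    ring
  · simp [g₀, extendByZero_of_not_mem u hw, hw]

/-- The solution of the discrete Dirichlet problem is unique (values off `S`, or merely on the
outer boundary, determine it on `S`). [folklore] -/
theorem isLatticeHarmonicOn_unique {S : Set (Site 2)} (hS : S.Finite) {u₁ u₂ : Site 2 → ℝ}
    (h₁ : IsLatticeHarmonicOn u₁ S) (h₂ : IsLatticeHarmonicOn u₂ S)
    (hb : ∀ w ∈ latticeOuterBoundary S, u₁ w = u₂ w) : Set.EqOn u₁ u₂ S :=
  fun v hv => h₁.eq_of_eq_boundary hS h₂ hb v hv

end Literature.Probability.LatticeModels
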